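import Mathlib

/-! # `DeepShellInvSum` — proof of the stub `stub_deepShellInvSum` of the SECOND LINE `weak` (exponent s = 1)
(route BlockLatticeFSum · item stmt-AtomisticToContinuum-27506 `DeepInfraredEmptiness` · decomp-a2c lens-6 g22;
critic row 300 R4 / row 303 (2)). DEF-FREE, Mathlib only:
`Σ_(q ≠ 0, ε(q) < θ) 1/ε(q) ≤ 6 √θ K³`, `ε(q) = Σ_j (1 − cos(2π q_j/K))`, `q : Fin 3 → Fin K`.
Proof: Jordan ⇒ `ε(q) ≥ 8 m(q)²/K²` (`m` = sup-norm of the centred representative) ⇒ `1/ε ≤ K²/(8m²)`;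
layer cake with the telescoping weights `1/m² = 1/(M+1)² + Σ_(t=m..M) (2t+1)/(t²(t+1)²)` and the product
count `#{m ≤ t} ≤ (2t+1)³` ⇒ `Σ 1/m² ≤ 81 M`; `8M² < θK²` ⇒ `2M ≤ K√θ` ⇒ total `≤ (81/16) √θ K³`. -/

noncomputable section

namespace Summit.AtomisticToContinuum.BoseEinsteinCondensation.Cruxes.DeepInfraredEmptiness.InvSumDF

open Finset

/-- The cyclic distance `min n (K − n)` of a residue is at most `K/2`. -/
theorem two_cdist_le (K : ℕ) (n : Fin K) : 2 * (min n.val (K - n.val) : ℕ) ≤ K := by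
  have := n.isLt; omega

/-- A non-zero residue has cyclic distance at least `1`. -/
theorem cdist_pos (K : ℕ) (n : Fin K) (hn : n.val ≠ 0) : 1 ≤ (min n.val (K - n.val) : ℕ) := by
  have := n.isLt; omega

/-- Each coordinate's cyclic distance is bounded by the sup over the three coordinates. -/
theorem cdist_le_csup (K : ℕ) (q : Fin 3 → Fin K) (j : Fin 3) : (min (q j).val (K - (q j).val) : ℕ) ≤ (Finset.univ.sup (fun j : Fin 3 => (min (q j).val (K - (q j).val) : ℕ)) : ℕ) :=
  Finset.le_sup (f := fun j : Fin 3 => (min (q j).val (K - (q j).val) : ℕ)) (Finset.mem_univ j)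

/-- The sup of the three cyclic distances is attained at some coordinate. -/
theorem exists_csup_eq (K : ℕ) (q : Fin 3 → Fin K) : ∃ j, (Finset.univ.sup (fun j : Fin 3 => (min (q j).val (K - (q j).val) : ℕ)) : ℕ) = (min (q j).val (K - (q j).val) : ℕ) := by
  obtain ⟨j, -, hj⟩ := Finset.exists_mem_eq_sup (Finset.univ : Finset (Fin 3)) Finset.univ_nonempty
    (fun j : Fin 3 => (min (q j).val (K - (q j).val) : ℕ))
  exact ⟨j, hj⟩

/-- Jordan: `8 d²/K² ≤ 1 − cos(2π n/K)` with `d` the centred distance. -/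
theorem jordan_cdist (K : ℕ) (hK : 0 < K) (n : Fin K) :
    (8 : ℝ) * ((min n.val (K - n.val) : ℕ) : ℝ) ^ 2 / (K : ℝ) ^ 2 ≤ 1 - Real.cos (2 * Real.pi * ((n : ℕ) : ℝ) / (K : ℝ)) := by
  have hKr : (0 : ℝ) < K := Nat.cast_pos.2 hK
  have hcos : Real.cos (2 * Real.pi * ((n : ℕ) : ℝ) / (K : ℝ)) =
      Real.cos (2 * Real.pi * ((min n.val (K - n.val) : ℕ) : ℝ) / (K : ℝ)) := by
    by_cases h : n.val ≤ K - n.val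
    · have : (min n.val (K - n.val) : ℕ) = n.val := min_eq_left h
      rw [this]
    · have hdn : (min n.val (K - n.val) : ℕ) = K - n.val := min_eq_right (not_le.1 h).le
      have hle : n.val ≤ K := n.isLt.le
      have hc : ((min n.val (K - n.val) : ℕ) : ℝ) = (K : ℝ) - (n.val : ℝ) := by rw [hdn, Nat.cast_sub hle]
      rw [hc]
      have : 2 * Real.pi * ((K : ℝ) - (n.val : ℝ)) / (K : ℝ) =
          2 * Real.pi - 2 * Real.pi * ((n : ℕ) : ℝ) / (K : ℝ) := by
        rw [mul_sub, sub_div, mul_div_assoc (2 * Real.pi) (K : ℝ) (K : ℝ), div_self hKr.ne', mul_one]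
      rw [this, Real.cos_two_pi_sub]
  rw [hcos]
  have h2d : 2 * (min n.val (K - n.val) : ℕ) ≤ K := two_cdist_le K n
  set d : ℕ := (min n.val (K - n.val) : ℕ) with hd
  set x : ℝ := Real.pi * (d : ℝ) / (K : ℝ) with hx
  have hx2 : 2 * Real.pi * (d : ℝ) / (K : ℝ) = 2 * x := by rw [hx]; ring
  rw [hx2, Real.cos_two_mul]
  have hx0 : 0 ≤ x := by rw [hx]; positivity
  have h2dr : (2 : ℝ) * (d : ℝ) ≤ (K : ℝ) := by exact_mod_cast h2d
  have hxπ : x ≤ Real.pi / 2 := by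
    rw [hx, div_le_div_iff₀ hKr two_pos]
    nlinarith [Real.pi_pos]
  have hsin : 2 / Real.pi * x ≤ Real.sin x := Real.mul_le_sin hx0 hxπ
  have hs0 : 0 ≤ 2 / Real.pi * x := by positivity
  have hsq : (2 / Real.pi * x) ^ 2 ≤ Real.sin x ^ 2 := pow_le_pow_left₀ hs0 hsin 2
  have hcs : Real.cos x ^ 2 = 1 - Real.sin x ^ 2 := by rw [← Real.sin_sq_add_cos_sq x]; ring
  have hxe : (2 / Real.pi * x) ^ 2 = 4 * (d : ℝ) ^ 2 / (K : ℝ) ^ 2 := by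
    rw [hx]; field_simp; ring
  rw [hxe] at hsq
  rw [hcs]
  have : (8 : ℝ) * (d : ℝ) ^ 2 / (K : ℝ) ^ 2 = 2 * (4 * (d : ℝ) ^ 2 / (K : ℝ) ^ 2) := by ring
  rw [this]
  nlinarith [hsq]

/-- telescoping weights for the inverse square: `Σ_(t = m..m+k) (2t+1)/(t²(t+1)²) = 1/m² − 1/(m+k+1)²`. -/
theorem telescope2 (m k : ℕ) (hm : 1 ≤ m) :
    ∑ t ∈ Finset.Icc m (m + k), (2 * (t : ℝ) + 1) / ((t : ℝ) ^ 2 * ((t : ℝ) + 1) ^ 2)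
      = 1 / (m : ℝ) ^ 2 - 1 / ((m : ℝ) + k + 1) ^ 2 := by
  have hm0 : (m : ℝ) ≠ 0 := by exact_mod_cast (Nat.one_le_iff_ne_zero.1 hm)
  have hmpos : (0 : ℝ) < m := by exact_mod_cast hm
  induction k with
  | zero =>
    simp only [add_zero, Finset.Icc_self, Finset.sum_singleton, Nat.cast_zero]
    field_simp
    ring
  | succ k ih =>
    rw [show m + (k + 1) = (m + k) + 1 by ring, Finset.sum_Icc_succ_top (by omega), ih]
    have h1 : (0 : ℝ) < (m : ℝ) + k + 1 := by positivity
    have h2 : (0 : ℝ) < (m : ℝ) + k + 1 + 1 := by positivity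
    push_cast
    field_simp
    ring

/-- at most `2t+1` residues have centred distance `≤ t`. -/
theorem card_filter_cdist_le (K t : ℕ) :
    ((Finset.univ : Finset (Fin K)).filter (fun n => (min n.val (K - n.val) : ℕ) ≤ t)).card ≤ 2 * t + 1 := by
  classical
  have hsub : (Finset.univ : Finset (Fin K)).filter (fun n => (min n.val (K - n.val) : ℕ) ≤ t) ⊆
      (Finset.univ.filter (fun n : Fin K => n.val ≤ t)) ∪
        (Finset.univ.filter (fun n : Fin K => K - n.val ≤ t)) := by
    intro n hn
    simp only [Finset.mem_filter, Finset.mem_univ, true_and, Finset.mem_union] at hn ⊢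
    rcases le_total n.val (K - n.val) with h | h
    · left; rw [min_eq_left h] at hn; exact hn
    · right; rw [min_eq_right h] at hn; exact hn
  refine (Finset.card_le_card hsub).trans ((Finset.card_union_le _ _).trans ?_)
  have h1 : (Finset.univ.filter (fun n : Fin K => n.val ≤ t)).card ≤ t + 1 := by
    have : (Finset.univ.filter (fun n : Fin K => n.val ≤ t)).card ≤ (Finset.range (t + 1)).card := by
      apply Finset.card_le_card_of_injOn (fun n => n.val)
      · intro n hn
        simp only [Finset.coe_filter, Finset.mem_univ, true_and, Set.mem_setOf_eq] at hn
        simp only [Finset.coe_range, Set.mem_Iio]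
        omega
      · intro a _ b _ h
        exact Fin.ext h
    simpa using this
  have h2 : (Finset.univ.filter (fun n : Fin K => K - n.val ≤ t)).card ≤ t := by
    have : (Finset.univ.filter (fun n : Fin K => K - n.val ≤ t)).card ≤ (Finset.range t).card := by
      apply Finset.card_le_card_of_injOn (fun n => K - 1 - n.val)
      · intro n hn
        simp only [Finset.coe_filter, Finset.mem_univ, true_and, Set.mem_setOf_eq] at hn
        simp only [Finset.coe_range, Set.mem_Iio]
        have := n.isLt
        omega
      · intro a ha b hb h
        simp only [Finset.coe_filter, Finset.mem_univ, true_and, Set.mem_setOf_eq] at ha hb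
        dsimp only at h
        have := a.isLt
        have := b.isLt
        exact Fin.ext (by omega)
    simpa using this
  omega

/-- PRODUCT count of the sup-norm sublevel set: `#{q ∈ Q : m(q) ≤ t} ≤ (2t+1)³`. -/
theorem card_sublevel_le (K t : ℕ) (Q : Finset (Fin 3 → Fin K)) :
    ((Q.filter fun q => (Finset.univ.sup (fun j : Fin 3 => (min (q j).val (K - (q j).val) : ℕ)) : ℕ) ≤ t).card : ℝ) ≤ (2 * (t : ℝ) + 1) ^ 3 := by
  classical
  have hsub : Q.filter (fun q => (Finset.univ.sup (fun j : Fin 3 => (min (q j).val (K - (q j).val) : ℕ)) : ℕ) ≤ t) ⊆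
      Fintype.piFinset (fun _ : Fin 3 => (Finset.univ : Finset (Fin K)).filter (fun n => (min n.val (K - n.val) : ℕ) ≤ t)) := by
    intro q hq
    rw [Finset.mem_filter] at hq
    rw [Fintype.mem_piFinset]
    intro j
    rw [Finset.mem_filter]
    exact ⟨Finset.mem_univ _, (cdist_le_csup K q j).trans hq.2⟩
  have h1 := Finset.card_le_card hsub
  rw [Fintype.card_piFinset, Finset.prod_const, Finset.card_univ, Fintype.card_fin] at h1
  have h3 : (Q.filter (fun q => (Finset.univ.sup (fun j : Fin 3 => (min (q j).val (K - (q j).val) : ℕ)) : ℕ) ≤ t)).card ≤ (2 * t + 1) ^ 3 :=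
    h1.trans (Nat.pow_le_pow_left (card_filter_cdist_le K t) 3)
  exact_mod_cast h3

/-- layer cake for the inverse square: `Σ_(q ∈ Q) 1/m(q)² ≤ 81 M` when `1 ≤ m(q) ≤ M` on `Q`. -/
theorem layer_bound2 (K M : ℕ) (hM : 1 ≤ M) (Q : Finset (Fin 3 → Fin K))
    (hQ : ∀ q ∈ Q, 1 ≤ (Finset.univ.sup (fun j : Fin 3 => (min (q j).val (K - (q j).val) : ℕ)) : ℕ) ∧ (Finset.univ.sup (fun j : Fin 3 => (min (q j).val (K - (q j).val) : ℕ)) : ℕ) ≤ M) :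
    ∑ q ∈ Q, (1 : ℝ) / ((Finset.univ.sup (fun j : Fin 3 => (min (q j).val (K - (q j).val) : ℕ)) : ℕ) : ℝ) ^ 2 ≤ 81 * (M : ℝ) := by
  classical
  have hMr : (1 : ℝ) ≤ M := by exact_mod_cast hM
  have step1 : ∀ q ∈ Q, (1 : ℝ) / ((Finset.univ.sup (fun j : Fin 3 => (min (q j).val (K - (q j).val) : ℕ)) : ℕ) : ℝ) ^ 2 =
      1 / ((M : ℝ) + 1) ^ 2 + ∑ t ∈ Finset.Icc 1 M,
        (if (Finset.univ.sup (fun j : Fin 3 => (min (q j).val (K - (q j).val) : ℕ)) : ℕ) ≤ t then (2 * (t : ℝ) + 1) / ((t : ℝ) ^ 2 * ((t : ℝ) + 1) ^ 2) else 0) := by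
    intro q hq
    obtain ⟨h1, h2⟩ := hQ q hq
    rw [← Finset.sum_filter]
    have hf : (Finset.Icc 1 M).filter (fun t => (Finset.univ.sup (fun j : Fin 3 => (min (q j).val (K - (q j).val) : ℕ)) : ℕ) ≤ t) =
        Finset.Icc (Finset.univ.sup (fun j : Fin 3 => (min (q j).val (K - (q j).val) : ℕ)) : ℕ) ((Finset.univ.sup (fun j : Fin 3 => (min (q j).val (K - (q j).val) : ℕ)) : ℕ) + (M - (Finset.univ.sup (fun j : Fin 3 => (min (q j).val (K - (q j).val) : ℕ)) : ℕ))) := by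
      ext t
      simp only [Finset.mem_filter, Finset.mem_Icc]
      omega
    rw [hf, telescope2 _ _ h1]
    have : (((Finset.univ.sup (fun j : Fin 3 => (min (q j).val (K - (q j).val) : ℕ)) : ℕ) : ℕ) : ℝ) + ((M - (Finset.univ.sup (fun j : Fin 3 => (min (q j).val (K - (q j).val) : ℕ)) : ℕ) : ℕ) : ℝ) + 1 = (M : ℝ) + 1 := by
      rw [Nat.cast_sub h2]; ring
    rw [this]
    ring
  rw [Finset.sum_congr rfl step1, Finset.sum_add_distrib, Finset.sum_const, Finset.sum_comm,
    nsmul_eq_mul]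
  have hcardQ : (Q.card : ℝ) ≤ (2 * (M : ℝ) + 1) ^ 3 := by
    have := card_sublevel_le K M Q
    have hQf : Q.filter (fun q => (Finset.univ.sup (fun j : Fin 3 => (min (q j).val (K - (q j).val) : ℕ)) : ℕ) ≤ M) = Q :=
      Finset.filter_true_of_mem fun q hq => (hQ q hq).2
    rwa [hQf] at this
  have hterm : ∀ t ∈ Finset.Icc 1 M,
      ∑ q ∈ Q, (if (Finset.univ.sup (fun j : Fin 3 => (min (q j).val (K - (q j).val) : ℕ)) : ℕ) ≤ t then (2 * (t : ℝ) + 1) / ((t : ℝ) ^ 2 * ((t : ℝ) + 1) ^ 2) else 0)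
        ≤ 54 := by
    intro t ht
    rw [Finset.mem_Icc] at ht
    have ht1 : (1 : ℝ) ≤ t := by exact_mod_cast ht.1
    rw [← Finset.sum_filter, Finset.sum_const, nsmul_eq_mul]
    have hc := card_sublevel_le K t Q
    have htpos : (0 : ℝ) < (t : ℝ) ^ 2 * ((t : ℝ) + 1) ^ 2 := by positivity
    calc ((Q.filter fun q => (Finset.univ.sup (fun j : Fin 3 => (min (q j).val (K - (q j).val) : ℕ)) : ℕ) ≤ t).card : ℝ) * ((2 * (t : ℝ) + 1) / ((t : ℝ) ^ 2 * ((t : ℝ) + 1) ^ 2))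
        ≤ (2 * (t : ℝ) + 1) ^ 3 * ((2 * (t : ℝ) + 1) / ((t : ℝ) ^ 2 * ((t : ℝ) + 1) ^ 2)) :=
          mul_le_mul_of_nonneg_right hc (by positivity)
      _ ≤ (3 * (t : ℝ)) ^ 3 * ((2 * (t : ℝ) + 1) / ((t : ℝ) ^ 2 * ((t : ℝ) + 1) ^ 2)) := by
          apply mul_le_mul_of_nonneg_right _ (by positivity)
          apply pow_le_pow_left₀ (by positivity)
          linarith
      _ = 27 * ((t : ℝ) * (2 * (t : ℝ) + 1) / ((t : ℝ) + 1) ^ 2) := by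
          field_simp
          ring
      _ ≤ 27 * 2 := by
          apply mul_le_mul_of_nonneg_left _ (by norm_num)
          rw [div_le_iff₀ (by positivity)]
          nlinarith
      _ = 54 := by norm_num
  have hsumt : ∑ t ∈ Finset.Icc 1 M, ∑ q ∈ Q,
      (if (Finset.univ.sup (fun j : Fin 3 => (min (q j).val (K - (q j).val) : ℕ)) : ℕ) ≤ t then (2 * (t : ℝ) + 1) / ((t : ℝ) ^ 2 * ((t : ℝ) + 1) ^ 2) else 0)
        ≤ ∑ t ∈ Finset.Icc 1 M, (54 : ℝ) := Finset.sum_le_sum hterm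
  rw [Finset.sum_const, Nat.card_Icc, nsmul_eq_mul] at hsumt
  have hcard : ((M + 1 - 1 : ℕ) : ℝ) = M := by simp
  rw [hcard] at hsumt
  have hA : (Q.card : ℝ) * (1 / ((M : ℝ) + 1) ^ 2) ≤ 27 * (M : ℝ) := by
    have hM1 : (0 : ℝ) < ((M : ℝ) + 1) ^ 2 := by positivity
    calc (Q.card : ℝ) * (1 / ((M : ℝ) + 1) ^ 2)
        ≤ (2 * (M : ℝ) + 1) ^ 3 * (1 / ((M : ℝ) + 1) ^ 2) :=
          mul_le_mul_of_nonneg_right hcardQ (by positivity)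
      _ ≤ (3 * (M : ℝ)) ^ 3 * (1 / ((M : ℝ) + 1) ^ 2) := by
          apply mul_le_mul_of_nonneg_right _ (by positivity)
          apply pow_le_pow_left₀ (by positivity)
          linarith
      _ = 27 * (M : ℝ) * ((M : ℝ) ^ 2 / ((M : ℝ) + 1) ^ 2) := by
          field_simp
          ring
      _ ≤ 27 * (M : ℝ) * 1 := by
          apply mul_le_mul_of_nonneg_left _ (by positivity)
          rw [div_le_one hM1]
          nlinarith
      _ = 27 * (M : ℝ) := by ring
  linarith [hA, hsumt]

/-- THE STUB's statement (verbatim signature of `stub_deepShellInvSum` of the `weak` line), with `C₀ = 6`. -/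
theorem deepShellInvSum :
    ∃ C₀ : ℝ, 0 < C₀ ∧ ∀ K : ℕ, 0 < K → ∀ θ : ℝ, 0 < θ → (∑ q ∈ (Finset.univ.filter fun q : Fin 3 → Fin K => ¬ (∀ j : Fin 3, (q j : ℕ) = 0) ∧ (∑ j : Fin 3, (1 - Real.cos (2 * Real.pi * ((q j : ℕ) : ℝ) / (K : ℝ)))) < θ), 1 / (∑ j : Fin 3, (1 - Real.cos (2 * Real.pi * ((q j : ℕ) : ℝ) / (K : ℝ))))) ≤ C₀ * Real.sqrt θ * (K : ℝ) ^ 3 := by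
  refine ⟨6, by norm_num, fun K hK θ hθ => ?_⟩
  classical
  have hKr : (0 : ℝ) < K := Nat.cast_pos.2 hK
  set Q := (Finset.univ.filter fun q : Fin 3 → Fin K => ¬ (∀ j : Fin 3, (q j : ℕ) = 0) ∧ (∑ j : Fin 3, (1 - Real.cos (2 * Real.pi * ((q j : ℕ) : ℝ) / (K : ℝ)))) < θ) with hQdef
  have hq_pos : ∀ q ∈ Q, 1 ≤ (Finset.univ.sup (fun j : Fin 3 => (min (q j).val (K - (q j).val) : ℕ)) : ℕ) := by
    intro q hq
    rw [hQdef, Finset.mem_filter] at hq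
    obtain ⟨-, hne, -⟩ := hq
    obtain ⟨j, hj⟩ := not_forall.1 hne
    exact (cdist_pos K (q j) hj).trans (cdist_le_csup K q j)
  have hq_eps : ∀ q ∈ Q, (8 : ℝ) * ((Finset.univ.sup (fun j : Fin 3 => (min (q j).val (K - (q j).val) : ℕ)) : ℕ) : ℝ) ^ 2 / (K : ℝ) ^ 2 ≤ (∑ j : Fin 3, (1 - Real.cos (2 * Real.pi * ((q j : ℕ) : ℝ) / (K : ℝ)))) := by
    intro q hq
    obtain ⟨j, hj⟩ := exists_csup_eq K q
    rw [hj]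
    refine (jordan_cdist K hK (q j)).trans ?_
    have := Finset.single_le_sum
      (f := fun i : Fin 3 => 1 - Real.cos (2 * Real.pi * ((q i : ℕ) : ℝ) / (K : ℝ)))
      (fun i _ => sub_nonneg.2 (Real.cos_le_one _)) (Finset.mem_univ j)
    simpa using this
  have hq_lt : ∀ q ∈ Q, (∑ j : Fin 3, (1 - Real.cos (2 * Real.pi * ((q j : ℕ) : ℝ) / (K : ℝ)))) < θ := by
    intro q hq
    rw [hQdef, Finset.mem_filter] at hq
    exact hq.2.2
  by_cases hQe : Q = ∅
  · rw [hQe, Finset.sum_empty]; positivity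
  obtain ⟨qs, hqs, hM⟩ := Finset.exists_mem_eq_sup Q (Finset.nonempty_iff_ne_empty.2 hQe)
    (fun q : Fin 3 → Fin K => (Finset.univ.sup (fun j : Fin 3 => (min (q j).val (K - (q j).val) : ℕ)) : ℕ))
  set M := Q.sup (fun q : Fin 3 → Fin K => (Finset.univ.sup (fun j : Fin 3 => (min (q j).val (K - (q j).val) : ℕ)) : ℕ)) with hMdef
  have hM1 : 1 ≤ M := by rw [hM]; exact hq_pos qs hqs
  have hMle : ∀ q ∈ Q, (Finset.univ.sup (fun j : Fin 3 => (min (q j).val (K - (q j).val) : ℕ)) : ℕ) ≤ M := fun q hq =>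
    Finset.le_sup (f := fun q : Fin 3 → Fin K => (Finset.univ.sup (fun j : Fin 3 => (min (q j).val (K - (q j).val) : ℕ)) : ℕ)) hq
  have hM2 : (8 : ℝ) * (M : ℝ) ^ 2 / (K : ℝ) ^ 2 < θ := by
    rw [hM]; exact (hq_eps qs hqs).trans_lt (hq_lt qs hqs)
  have hMr1 : (1 : ℝ) ≤ M := by exact_mod_cast hM1
  -- 2M ≤ K √θ
  have h2M : 2 * (M : ℝ) ≤ (K : ℝ) * Real.sqrt θ := by
    rw [div_lt_iff₀ (by positivity)] at hM2
    have h4 : (2 * (M : ℝ)) ^ 2 ≤ θ * (K : ℝ) ^ 2 := by nlinarith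
    have : 2 * (M : ℝ) ≤ Real.sqrt (θ * (K : ℝ) ^ 2) := by
      rw [Real.le_sqrt (by positivity) (by positivity)]
      exact h4
    rw [Real.sqrt_mul hθ.le, Real.sqrt_sq hKr.le] at this
    calc 2 * (M : ℝ) ≤ Real.sqrt θ * (K : ℝ) := this
      _ = (K : ℝ) * Real.sqrt θ := mul_comm _ _
  have hpt : ∀ q ∈ Q, 1 / (∑ j : Fin 3, (1 - Real.cos (2 * Real.pi * ((q j : ℕ) : ℝ) / (K : ℝ)))) ≤ (K : ℝ) ^ 2 / 8 * (1 / ((Finset.univ.sup (fun j : Fin 3 => (min (q j).val (K - (q j).val) : ℕ)) : ℕ) : ℝ) ^ 2) := by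
    intro q hq
    have hm : (1 : ℝ) ≤ (Finset.univ.sup (fun j : Fin 3 => (min (q j).val (K - (q j).val) : ℕ)) : ℕ) := by exact_mod_cast hq_pos q hq
    have hpos : (0 : ℝ) < 8 * ((Finset.univ.sup (fun j : Fin 3 => (min (q j).val (K - (q j).val) : ℕ)) : ℕ) : ℝ) ^ 2 / (K : ℝ) ^ 2 := by positivity
    calc 1 / (∑ j : Fin 3, (1 - Real.cos (2 * Real.pi * ((q j : ℕ) : ℝ) / (K : ℝ))))
        ≤ 1 / (8 * ((Finset.univ.sup (fun j : Fin 3 => (min (q j).val (K - (q j).val) : ℕ)) : ℕ) : ℝ) ^ 2 / (K : ℝ) ^ 2) := one_div_le_one_div_of_le hpos (hq_eps q hq)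
      _ = (K : ℝ) ^ 2 / 8 * (1 / ((Finset.univ.sup (fun j : Fin 3 => (min (q j).val (K - (q j).val) : ℕ)) : ℕ) : ℝ) ^ 2) := by
          field_simp
  calc ∑ q ∈ Q, 1 / (∑ j : Fin 3, (1 - Real.cos (2 * Real.pi * ((q j : ℕ) : ℝ) / (K : ℝ))))
      ≤ ∑ q ∈ Q, (K : ℝ) ^ 2 / 8 * (1 / ((Finset.univ.sup (fun j : Fin 3 => (min (q j).val (K - (q j).val) : ℕ)) : ℕ) : ℝ) ^ 2) := Finset.sum_le_sum hpt
    _ = (K : ℝ) ^ 2 / 8 * ∑ q ∈ Q, 1 / ((Finset.univ.sup (fun j : Fin 3 => (min (q j).val (K - (q j).val) : ℕ)) : ℕ) : ℝ) ^ 2 := by rw [Finset.mul_sum]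
    _ ≤ (K : ℝ) ^ 2 / 8 * (81 * (M : ℝ)) := by
        apply mul_le_mul_of_nonneg_left _ (by positivity)
        exact layer_bound2 K M hM1 Q fun q hq => ⟨hq_pos q hq, hMle q hq⟩
    _ = (81 / 16) * (K : ℝ) ^ 2 * (2 * (M : ℝ)) := by ring
    _ ≤ (81 / 16) * (K : ℝ) ^ 2 * ((K : ℝ) * Real.sqrt θ) :=
        mul_le_mul_of_nonneg_left h2M (by positivity)
    _ = (81 / 16) * (Real.sqrt θ * (K : ℝ) ^ 3) := by ring
    _ ≤ 6 * Real.sqrt θ * (K : ℝ) ^ 3 := by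
        have hX : 0 ≤ Real.sqrt θ * (K : ℝ) ^ 3 := by positivity
        nlinarith [hX]

/-- STUB FORM: name + signature of `stub_deepShellInvSum` (line `weak` of item stmt-AtomisticToContinuum-27506). -/
theorem stub_deepShellInvSum :
    ∃ C₀ : ℝ, 0 < C₀ ∧ ∀ K : ℕ, 0 < K → ∀ θ : ℝ, 0 < θ → (∑ q ∈ (Finset.univ.filter fun q : Fin 3 → Fin K => ¬ (∀ j : Fin 3, (q j : ℕ) = 0) ∧ (∑ j : Fin 3, (1 - Real.cos (2 * Real.pi * ((q j : ℕ) : ℝ) / (K : ℝ)))) < θ), 1 / (∑ j : Fin 3, (1 - Real.cos (2 * Real.pi * ((q j : ℕ) : ℝ) / (K : ℝ))))) ≤ C₀ * Real.sqrt θ * (K : ℝ) ^ 3 :=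
  deepShellInvSum

end Summit.AtomisticToContinuum.BoseEinsteinCondensation.Cruxes.DeepInfraredEmptiness.InvSumDF

end
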